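import Literature.NumberTheory.DiophantineApproximation.RidoutIntegers
import Summits.ABC.ABC.Theses.IneffectiveSubspace

/-!
# `UniformSadicTowerFour` (stmt-ABC-14937), line `flat-steep-split` (lead c5): the ONE-LOG AXIS
# U₁ = UPD(1,1) for a FIXED modulus prime `p`, uniformly in the base — a THEOREM (`p`-adic Roth)

The one-logarithm axis of the first open rung `W = 3` of the crux's necessary condition is the
ONE-PRIME / ONE-BASE divisibility bound **U₁ = UPD(1,1)** (file `…OneLogAxis.lean`, where it is
derived from the crux and from `ABC`; uniformly in both primes it is abc-type and OPEN): for `ε > 0`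
a constant `C` with

  `p^t ≤ C · (pr)^(1+ε) · (r^Z)^ε`  whenever `p ≠ r` are primes, `p^t ∣ r^Z − 1`, `r^Z ≥ 2`.

This file proves U₁ UNCONDITIONALLY for every FIXED modulus prime `p`, with a constant `C = C(p, ε)`,
UNIFORMLY in the base prime `r` and in the exponents `Z, t`:

* `oneBase_fixedModulus` — `∀ p prime, ∀ ε > 0, ∃ C > 0, ∀ r prime ≠ p, ∀ Z t,
  p^t ∣ r^Z − 1 → r^Z ≥ 2 → p^t ≤ C (pr)^(1+ε) (r^Z)^ε` (the registered stub);
* `padicValNat_pow_sub_one_le` — its Wieferich-exponent reading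
  `v_p(r^Z − 1) · log p ≤ (1+ε) log r + log Z + C(p, ε)` for primes `r ≠ p`, `Z ≥ 1`.

So per fixed modulus the one-log axis is a theorem (a prime `r` cannot be `p`-adically super-close
to a `(p−1)`-th root of unity: `p`-adic Roth), whereas the two-log axis per fixed modulus is already
Wieferich-hard and full uniformity in `p` is the cyclotomic large-square problem (sibling files
`…OneLogAxis.lean`, `…OnePrimeCyclotomicSquare.lean`).

**Proof.** Fix `p`, `ε`; put `m := 2(p − 1) ≥ 2` and `f := X^m − 1 ∈ ℤ[X]` (degree `m`, separable
over `ℚ`).  (1) DIOPHANTINE INPUT.  The tree's theorem `[f(x)]_S ≪ max(1,|x|)^{1+mε'}`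
(Bugeaud–Evertse–Győry 2018, Thm. 2.1 (i), a consequence of the `p`-adic Thue–Siegel–Roth theorem of
Ridout — PROVED in the tree: `BugeaudEvertseGyory2018_SPartPolynomialValues_holds` and its corollary
`….le_pow_max`) at `S = {p}`, `ε' = ε/m` gives `C₀` with `p^{v_p(r^m − 1)} ≤ C₀ · r^{1+ε}` for every
`r ≥ 2` (`olrPart_pow_sub_one_le`).  (2) LIFTING THE EXPONENT.  For primes `r ≠ p` and `Z ≥ 1`:
`v_p(r^Z − 1) ≤ v_p(r^{mZ} − 1) = v_p(r^m − 1) + v_p(Z)` — for odd `p` by the LTE lemma applied to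
`x = r^m` (`p ∣ r^m − 1` by Fermat, `p ∤ r^m`), for `p = 2` (`m = 2`, `r` odd) by the `2`-adic LTE
`v_2(r^{2Z} − 1) + 1 = v_2(r+1) + v_2(r−1) + v_2(2Z)` (`olrVal_le`).  (3) Hence, for `p^t ∣ r^Z − 1`,
`p^t ≤ p^{v_p(r^m−1)} · p^{v_p(Z)} ≤ C₀ r^{1+ε} · Z` (`olrPow_le_mul`, `olrMaster`), and
`Z · ε log 2 ≤ (r^Z)^ε` (`olrNat_mul_le_rpow`: `(r^Z)^ε = exp(εZ log r) ≥ 1 + εZ log r`),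
`r^{1+ε} ≤ (pr)^{1+ε}`; so `C := C₀/(ε log 2)` works.  Taking logarithms in (3) at
`t = v_p(r^Z − 1)` gives the Wieferich-exponent reading.

Sources: Y. Bugeaud, J.-H. Evertse, K. Győry, Acta Arith. 184 (2018), Thm. 2.1 (i)
[BugeaudEvertseGyory2018]; D. Ridout, Mathematika 5 (1958) [Ridout1958]; E. Bombieri, W. Gubler,
*Heights in Diophantine Geometry*, Thm. 6.2.3 [BombieriGubler2006]; the lifting-the-exponent lemma
and Fermat's little theorem [folklore] (Mathlib: `padicValNat.pow_sub_pow`,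
`padicValNat.pow_two_sub_one`, `Nat.ModEq.pow_totient`, `pow_padicValNat_dvd`,
`padicValNat_dvd_iff_le`, `Nat.pow_sub_one_dvd_pow_sub_one`, `Polynomial.separable_X_pow_sub_C`,
`Real.add_one_le_exp`).  No new definitions, no hypotheses.  Deliberately NOT here: U₁ uniformly in
`p` (OPEN), the two-log axis, the other stubs of the line (other files).
-/

noncomputable section

-- `Summit.<Summit>.<Problem>` is the mandated summit-side namespace (CONVENTIONS §2); for the
-- single-conjunct summit `ABC` the two coincide, so the duplicate `ABC.ABC` is deliberate.
set_option linter.dupNamespace false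

namespace Summit.ABC.ABC.Theorems.UniformSadicTowerFour.BoundedOmega

open Polynomial
open Literature.NumberTheory.DiophantineApproximation (sPart
  BugeaudEvertseGyory2018_SPartPolynomialValues_holds)

/-! ## The Diophantine input: the `p`-part of `r^m − 1` is `≪ r^{1+mε}` -/

/-- **The `p`-part of `r^m − 1` is sub-polynomially small** (from the `p`-adic Thue–Siegel–Roth
theorem).  For a prime `p`, `m ≥ 2` and `ε > 0` there is `C > 0` with
`p^{v_p(r^m − 1)} ≤ C · r^{1+mε}` for every integer `r ≥ 2`: Bugeaud–Evertse–Győry 2018, Thm. 2.1 (i)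
in the shape `[f(x)]_S ≤ C max(1,|x|)^{1+nε}` (`….le_pow_max`, PROVED in the tree on top of Ridout's
theorem) for `f = X^m − 1` (degree `m`, separable over `ℚ`) and `S = {p}`, where
`[f(r)]_{{p}} = p^{v_p(r^m − 1)}`.
[cite: BugeaudEvertseGyory2018, Thm. 2.1 (i)] [cite: Ridout1958] [cite: BombieriGubler2006, Thm. 6.2.3] -/
private theorem olrPart_pow_sub_one_le {p m : ℕ} (hp : p.Prime) (hm : 2 ≤ m) {ε : ℝ}
    (hε : 0 < ε) :
    ∃ C : ℝ, 0 < C ∧ ∀ r : ℕ, 2 ≤ r →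
      ((p ^ padicValNat p (r ^ m - 1) : ℕ) : ℝ) ≤ C * (r : ℝ) ^ (1 + m * ε) := by
  set f : ℤ[X] := X ^ m - C 1 with hf
  have hdeg : f.natDegree = m := natDegree_X_pow_sub_C
  have hsep : (f.map (Int.castRingHom ℚ)).Separable := by
    have hmap : f.map (Int.castRingHom ℚ) = X ^ m - C 1 := by
      rw [hf, Polynomial.map_sub, Polynomial.map_pow, map_X, map_C, map_one]
    rw [hmap]
    exact separable_X_pow_sub_C (1 : ℚ) (by exact_mod_cast (show m ≠ 0 by omega)) one_ne_zero
  obtain ⟨C, hC, hb⟩ := BugeaudEvertseGyory2018_SPartPolynomialValues_holds.le_pow_max f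
    (by rw [hdeg]; exact hm) hsep {p} (by simpa using hp) hε
  refine ⟨C, hC, fun r hr => ?_⟩
  have hm1 : 1 < r ^ m := Nat.one_lt_pow (by omega) (by omega)
  have hcast : ((r ^ m - 1 : ℕ) : ℤ) = (r : ℤ) ^ m - 1 := by
    rw [Nat.cast_sub hm1.le, Nat.cast_pow, Nat.cast_one]
  have heval : f.eval (r : ℤ) = ((r ^ m - 1 : ℕ) : ℤ) := by
    rw [hcast, hf, eval_sub, eval_pow, eval_X, eval_C]
  have hne : f.eval (r : ℤ) ≠ 0 := by
    rw [heval]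
    exact_mod_cast (show r ^ m - 1 ≠ 0 by omega)
  have key := hb (r : ℤ) hne
  have hs : sPart {p} (f.eval (r : ℤ)) = p ^ padicValNat p (r ^ m - 1) := by
    unfold sPart
    rw [Finset.prod_singleton, heval, padicValInt.of_nat]
  have hmax : max 1 |((r : ℤ) : ℝ)| = (r : ℝ) := by
    rw [Int.cast_natCast, Nat.abs_cast]
    exact max_eq_right (by exact_mod_cast (show 1 ≤ r by omega))
  rw [hs, hmax, hdeg] at key
  exact key

/-! ## Lifting the exponent: `v_p(r^Z − 1) ≤ v_p(r^{2(p−1)} − 1) + v_p(Z)` -/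

/-- **Fermat.** For distinct primes `p, r`: `p ∣ r^{2(p−1)} − 1` (Euler–Fermat for `r²`, coprime
to `p`) and `p ∤ r^{2(p−1)}` (else `p ∣ r`, `p = r`). [folklore] -/
private theorem olrFermat {p r : ℕ} (hp : p.Prime) (hr : r.Prime) (hpr : p ≠ r) :
    p ∣ r ^ (2 * (p - 1)) - 1 ∧ ¬p ∣ r ^ (2 * (p - 1)) := by
  have hcop : Nat.Coprime (r ^ 2) p := ((Nat.coprime_primes hr hp).mpr hpr.symm).pow_left 2
  have hF : (r ^ 2) ^ (p - 1) ≡ 1 [MOD p] := by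
    have h := Nat.ModEq.pow_totient hcop
    rwa [Nat.totient_prime hp] at h
  rw [← pow_mul] at hF
  exact ⟨(Nat.modEq_iff_dvd' (Nat.one_le_pow _ _ hr.pos)).mp hF.symm,
    fun h => hpr ((Nat.prime_dvd_prime_iff_eq hp hr).mp (hp.dvd_of_dvd_pow h))⟩

/-- **LTE bound.** For distinct primes `p, r` and `Z ≥ 1`, with `m = 2(p − 1)`:
`v_p(r^Z − 1) ≤ v_p(r^m − 1) + v_p(Z)`.  Indeed `r^Z − 1 ∣ r^{mZ} − 1`; for odd `p` the
lifting-the-exponent lemma gives `v_p((r^m)^Z − 1) = v_p(r^m − 1) + v_p(Z)` (`p ∣ r^m − 1` by Fermat,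
`p ∤ r^m`), and for `p = 2` (`m = 2`, `r` odd) the `2`-adic one gives
`v_2(r^{2Z} − 1) + 1 = v_2(r+1) + v_2(r−1) + v_2(2Z) = v_2(r² − 1) + 1 + v_2(Z)`. [folklore] -/
private theorem olrVal_le {p r Z : ℕ} (hp : p.Prime) (hr : r.Prime) (hpr : p ≠ r) (hZ : Z ≠ 0) :
    padicValNat p (r ^ Z - 1) ≤ padicValNat p (r ^ (2 * (p - 1)) - 1) + padicValNat p Z := by
  haveI := Fact.mk hp
  have hr1 : 1 < r := hr.one_lt
  have hm0 : 2 * (p - 1) ≠ 0 := by have := hp.two_le; omega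
  -- `v_p(r^Z - 1) ≤ v_p(r^(mZ) - 1)`
  have hbig : 1 < r ^ (2 * (p - 1) * Z) := Nat.one_lt_pow (Nat.mul_ne_zero hm0 hZ) hr1
  have hA : padicValNat p (r ^ Z - 1) ≤ padicValNat p (r ^ (2 * (p - 1) * Z) - 1) :=
    (padicValNat_dvd_iff_le (by omega)).mp
      (pow_padicValNat_dvd.trans (Nat.pow_sub_one_dvd_pow_sub_one r (Dvd.intro_left _ rfl)))
  refine hA.trans ?_
  rcases hp.eq_two_or_odd' with rfl | hodd
  · -- `p = 2`, `m = 2`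
    have h2r : ¬2 ∣ r := fun h => hpr ((Nat.prime_dvd_prime_iff_eq Nat.prime_two hr).mp h)
    have key := padicValNat.pow_two_sub_one hr1 h2r (by omega : 2 * Z ≠ 0) (even_two_mul Z)
    have hmul : padicValNat 2 (2 * Z) = 1 + padicValNat 2 Z := by
      rw [padicValNat.mul two_ne_zero hZ, padicValNat_self]
    have hsq : padicValNat 2 (r ^ 2 - 1) = padicValNat 2 (r + 1) + padicValNat 2 (r - 1) := by
      rw [show r ^ 2 - 1 = (r + 1) * (r - 1) by simpa using Nat.pow_two_sub_pow_two r 1,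
        padicValNat.mul (by omega) (by omega)]
    have h21 : (2 : ℕ) * (2 - 1) = 2 := rfl
    rw [h21]
    omega
  · -- `p` odd
    obtain ⟨hdvd, hndvd⟩ := olrFermat hp hr hpr
    have hx : 1 < r ^ (2 * (p - 1)) := Nat.one_lt_pow hm0 hr1
    have key := padicValNat.pow_sub_pow hodd hx hdvd hndvd hZ
    rw [one_pow] at key
    rw [pow_mul r (2 * (p - 1)) Z]
    exact key.le

/-! ## Real bookkeeping: `Z · ε log 2 ≤ (r^Z)^ε` -/

/-- For `r ≥ 2`, `Z ∈ ℕ` and `η > 0`: `Z · (η log 2) ≤ (r^Z)^η`, since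
`(r^Z)^η = exp(η Z log r) ≥ 1 + η Z log r ≥ η Z log 2`. [folklore] -/
private theorem olrNat_mul_le_rpow {r : ℕ} (hr : 2 ≤ r) (Z : ℕ) {η : ℝ} (hη : 0 < η) :
    (Z : ℝ) * (η * Real.log 2) ≤ ((r ^ Z : ℕ) : ℝ) ^ η := by
  have hr0 : (0 : ℝ) < r := by exact_mod_cast (show 0 < r by omega)
  have hlog2 : Real.log 2 ≤ Real.log r := Real.log_le_log two_pos (by exact_mod_cast hr)
  rw [Nat.cast_pow, Real.rpow_def_of_pos (pow_pos hr0 Z), Real.log_pow]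
  calc (Z : ℝ) * (η * Real.log 2) ≤ (Z : ℝ) * (η * Real.log r) :=
        mul_le_mul_of_nonneg_left (mul_le_mul_of_nonneg_left hlog2 hη.le) (Nat.cast_nonneg Z)
    _ = (Z : ℝ) * Real.log r * η := by ring
    _ ≤ (Z : ℝ) * Real.log r * η + 1 := le_add_of_nonneg_right zero_le_one
    _ ≤ Real.exp ((Z : ℝ) * Real.log r * η) := Real.add_one_le_exp _

/-! ## The master bound `p^t ≤ C₀ · r^{1+ε} · Z` -/

/-- **The integer step.** For a prime `p` there is `m ≥ 2` (namely `m = 2(p − 1)`) with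
`p^t ≤ p^{v_p(r^m − 1)} · Z` whenever `r ≠ p` is prime, `Z ≥ 1` and `p^t ∣ r^Z − 1`:
`t ≤ v_p(r^Z − 1) ≤ v_p(r^m − 1) + v_p(Z)` (`olrVal_le`) and `p^{v_p(Z)} ∣ Z`. [folklore] -/
private theorem olrPow_le_mul {p : ℕ} (hp : p.Prime) :
    ∃ m : ℕ, 2 ≤ m ∧ ∀ r Z t : ℕ, r.Prime → p ≠ r → Z ≠ 0 → p ^ t ∣ r ^ Z - 1 →
      p ^ t ≤ p ^ padicValNat p (r ^ m - 1) * Z := by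
  haveI := Fact.mk hp
  refine ⟨2 * (p - 1), by have := hp.two_le; omega, fun r Z t hr hpr hZ hdvd => ?_⟩
  have hb : r ^ Z - 1 ≠ 0 := by
    have := Nat.one_lt_pow hZ hr.one_lt
    omega
  have ht : t ≤ padicValNat p (r ^ Z - 1) := (padicValNat_dvd_iff_le hb).mp hdvd
  calc p ^ t ≤ p ^ (padicValNat p (r ^ (2 * (p - 1)) - 1) + padicValNat p Z) :=
        Nat.pow_le_pow_right hp.pos (ht.trans (olrVal_le hp hr hpr hZ))
    _ = p ^ padicValNat p (r ^ (2 * (p - 1)) - 1) * p ^ padicValNat p Z := pow_add _ _ _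
    _ ≤ p ^ padicValNat p (r ^ (2 * (p - 1)) - 1) * Z :=
        Nat.mul_le_mul_left _ (Nat.le_of_dvd (Nat.pos_of_ne_zero hZ) pow_padicValNat_dvd)

/-- **The master bound.** For a prime `p` and `ε > 0` there is `C₀ = C₀(p, ε) > 0` with
`p^t ≤ C₀ · r^{1+ε} · Z` (in `ℝ`) whenever `r ≠ p` is prime, `Z ≥ 1` and `p^t ∣ r^Z − 1`: the
integer step `p^t ≤ p^{v_p(r^m − 1)} · Z` (`olrPow_le_mul`) and the Diophantine input
`p^{v_p(r^m − 1)} ≤ C₀ r^{1 + m(ε/m)}` (`olrPart_pow_sub_one_le` at `ε/m`).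
[cite: BugeaudEvertseGyory2018, Thm. 2.1 (i)] [cite: Ridout1958] -/
private theorem olrMaster {p : ℕ} (hp : p.Prime) {ε : ℝ} (hε : 0 < ε) :
    ∃ C₀ : ℝ, 0 < C₀ ∧ ∀ r Z t : ℕ, r.Prime → p ≠ r → Z ≠ 0 → p ^ t ∣ r ^ Z - 1 →
      ((p ^ t : ℕ) : ℝ) ≤ C₀ * (r : ℝ) ^ (1 + ε) * Z := by
  obtain ⟨m, hm2, hnat⟩ := olrPow_le_mul hp
  have hm0 : (0 : ℝ) < m := by exact_mod_cast (show 0 < m by omega)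
  obtain ⟨C₀, hC₀, hB⟩ := olrPart_pow_sub_one_le hp hm2 (div_pos hε hm0)
  have hexp : 1 + (m : ℝ) * (ε / m) = 1 + ε := by rw [mul_div_cancel₀ _ hm0.ne']
  refine ⟨C₀, hC₀, fun r Z t hr hpr hZ hdvd => ?_⟩
  have hA := hB r hr.two_le
  rw [hexp] at hA
  calc ((p ^ t : ℕ) : ℝ) ≤ ((p ^ padicValNat p (r ^ m - 1) : ℕ) : ℝ) * Z := by
        exact_mod_cast hnat r Z t hr hpr hZ hdvd
    _ ≤ C₀ * (r : ℝ) ^ (1 + ε) * Z := mul_le_mul_of_nonneg_right hA (Nat.cast_nonneg Z)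

/-! ## U₁ for a fixed modulus, uniformly in the base -/

/-- **The one-log axis U₁ = UPD(1,1) for a FIXED modulus prime is a theorem, uniformly in the
base.**  For every prime `p` and `ε > 0` there is `C = C(p, ε) > 0` such that for every prime
`r ≠ p` and all `Z, t ∈ ℕ` with `p^t ∣ r^Z − 1` and `r^Z ≥ 2`:
`p^t ≤ C · (pr)^(1+ε) · (r^Z)^ε`.  Proof: with `m = 2(p−1)`, `t ≤ v_p(r^Z − 1) ≤ v_p(r^m − 1) + v_p(Z)`
(lifting the exponent, `olrVal_le`), so `p^t ≤ p^{v_p(r^m − 1)} · Z`; the `p`-adic Thue–Siegel–Roth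
theorem in the form of Bugeaud–Evertse–Győry Thm. 2.1 (i) bounds `p^{v_p(r^m − 1)} ≤ C₀ r^{1+ε}`
(`olrMaster`), and `Z ≤ (r^Z)^ε / (ε log 2)` (`olrNat_mul_le_rpow`), `r ≤ pr`; take
`C = C₀ / (ε log 2)`.  The constant is ineffective (Roth).
[cite: BugeaudEvertseGyory2018, Thm. 2.1 (i)] [cite: Ridout1958] [cite: BombieriGubler2006, Thm. 6.2.3] -/
theorem oneBase_fixedModulus :
    ∀ p : ℕ, p.Prime → ∀ ε : ℝ, 0 < ε → ∃ C : ℝ, 0 < C ∧ ∀ r : ℕ, r.Prime → p ≠ r → ∀ Z t : ℕ,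
      p ^ t ∣ r ^ Z - 1 → 2 ≤ r ^ Z →
      ((p ^ t : ℕ) : ℝ) ≤ C * ((p * r : ℕ) : ℝ) ^ (1 + ε) * ((r ^ Z : ℕ) : ℝ) ^ ε := by
  intro p hp ε hε
  obtain ⟨C₀, hC₀, hM⟩ := olrMaster hp hε
  have hlog : 0 < ε * Real.log 2 := mul_pos hε (Real.log_pos one_lt_two)
  refine ⟨C₀ / (ε * Real.log 2), div_pos hC₀ hlog, ?_⟩
  intro r hr hpr Z t hdvd h2
  have hZ : Z ≠ 0 := by
    rintro rfl
    rw [pow_zero] at h2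
    omega
  have hr2 : 2 ≤ r := hr.two_le
  have hZle : (Z : ℝ) ≤ ((r ^ Z : ℕ) : ℝ) ^ ε / (ε * Real.log 2) := by
    rw [le_div_iff₀ hlog]
    exact olrNat_mul_le_rpow hr2 Z hε
  have hpr_le : (r : ℝ) ^ (1 + ε) ≤ ((p * r : ℕ) : ℝ) ^ (1 + ε) :=
    Real.rpow_le_rpow (Nat.cast_nonneg r) (by exact_mod_cast Nat.le_mul_of_pos_left r hp.pos)
      (by linarith)
  calc ((p ^ t : ℕ) : ℝ) ≤ C₀ * (r : ℝ) ^ (1 + ε) * Z := hM r Z t hr hpr hZ hdvd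
    _ ≤ C₀ * (r : ℝ) ^ (1 + ε) * (((r ^ Z : ℕ) : ℝ) ^ ε / (ε * Real.log 2)) := by gcongr
    _ = C₀ / (ε * Real.log 2) * (r : ℝ) ^ (1 + ε) * ((r ^ Z : ℕ) : ℝ) ^ ε := by ring
    _ ≤ C₀ / (ε * Real.log 2) * ((p * r : ℕ) : ℝ) ^ (1 + ε) * ((r ^ Z : ℕ) : ℝ) ^ ε := by
        gcongr

/-! ## The Wieferich-exponent reading -/

/-- **Wieferich-exponent reading.** For a fixed prime `p` and `ε > 0` there is `C` with
`v_p(r^Z − 1) · log p ≤ (1+ε) · log r + log Z + C` for all primes `r ≠ p` and all `Z ≥ 1` — the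
exponent of `p` in `r^Z − 1` exceeds the trivial `v_p(Z)`-type contribution by at most
`((1+ε) log r + O_{p,ε}(1)) / log p`: take logarithms in `p^{v_p(r^Z − 1)} ≤ C₀ · r^{1+ε} · Z`
(`olrMaster` at `t = v_p(r^Z − 1)`), `C = log C₀`.
[cite: BugeaudEvertseGyory2018, Thm. 2.1 (i)] [cite: Ridout1958] -/
theorem padicValNat_pow_sub_one_le :
    ∀ p : ℕ, p.Prime → ∀ ε : ℝ, 0 < ε → ∃ C : ℝ, ∀ r : ℕ, r.Prime → p ≠ r → ∀ Z : ℕ, 1 ≤ Z →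
      (padicValNat p (r ^ Z - 1) : ℝ) * Real.log p ≤ (1 + ε) * Real.log r + Real.log Z + C := by
  intro p hp ε hε
  obtain ⟨C₀, hC₀, hM⟩ := olrMaster hp hε
  refine ⟨Real.log C₀, fun r hr hpr Z hZ1 => ?_⟩
  have hZ : Z ≠ 0 := by omega
  have hp0 : (0 : ℝ) < p := by exact_mod_cast hp.pos
  have hr0 : (0 : ℝ) < r := by exact_mod_cast hr.pos
  have hZ0 : (0 : ℝ) < Z := by exact_mod_cast Nat.pos_of_ne_zero hZ
  have hrε : (0 : ℝ) < (r : ℝ) ^ (1 + ε) := Real.rpow_pos_of_pos hr0 _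
  have key := hM r Z (padicValNat p (r ^ Z - 1)) hr hpr hZ pow_padicValNat_dvd
  rw [Nat.cast_pow] at key
  have hlog := Real.log_le_log (pow_pos hp0 _) key
  rw [Real.log_pow, Real.log_mul (mul_pos hC₀ hrε).ne' hZ0.ne', Real.log_mul hC₀.ne' hrε.ne',
    Real.log_rpow hr0] at hlog
  linarith

end Summit.ABC.ABC.Theorems.UniformSadicTowerFour.BoundedOmega

end
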